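import Summits.BirchSwinnertonDyer.BirchSwinnertonDyer.Theses.GenusKolyvaginAtTwo
import Summits.BirchSwinnertonDyer.BirchSwinnertonDyer.Theorems.GenusKolyvaginAtTwoK4NegOffCutNonPhantomAtTwoMult
import Summits.BirchSwinnertonDyer.BirchSwinnertonDyer.Theorems.GenusKolyvaginAtTwoGenusDeepSupplyAtTwoNegDiscNarrowKFourCellLeafCurrency
import Summits.BirchSwinnertonDyer.BirchSwinnertonDyer.Theses.ByReductionTypeAtTwo
import Summits.BirchSwinnertonDyer.BirchSwinnertonDyer.Theorems.GenusKolyvaginAtTwoGenusPrimitiveSupplyAtTwoPosDiscShallowKFourPosBTwoSharpIff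
import Summits.BirchSwinnertonDyer.BirchSwinnertonDyer.Theorems.GenusKolyvaginAtTwoGenusDeepSupplyAtTwoNegDiscNarrowKFourCellShaCardCurrency
import Summits.BirchSwinnertonDyer.BirchSwinnertonDyer.Theorems.GenusKolyvaginAtTwoGenusPrimitiveSupplyAtTwoPosDiscShallowKFourPosHalvingDescentCorollaries
import Summits.BirchSwinnertonDyer.BirchSwinnertonDyer.Theorems.GenusKolyvaginAtTwoMinimalTwinBSDTwoSwappedPairFrame
import Summits.BirchSwinnertonDyer.BirchSwinnertonDyer.Theorems.GenusKolyvaginAtTwoK4NegTwinBsdRoadNonPhantomTwoAdicIff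
import Summits.BirchSwinnertonDyer.BirchSwinnertonDyer.Theorems.GenusKolyvaginAtTwoOffCutResidualAtTwoRLw2PhantomExclusionKLW
import Literature.NumberTheory.EllipticCurves.HeegnerPointsKolyvaginExceptionalTwistProofs
import Literature.NumberTheory.EllipticCurves.BSDRootNumberSmallConductorProofs
import HarnessLib

/-!
# LINE 37 «frobenius_split» — bsd-idea-1 g28 (ideator; technique card «compactness–contradiction / rigidity»), on the crux
`K4Neg` (stmt-BirchSwinnertonDyer-31526) of route GenusKolyvaginAtTwo (GK2).  No summit is proved by a line; `K4Neg` is NOT proved here.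

## Idea (one paragraph)
LINE 34 v1.5 reduced `K4Neg` — modulo the route's OWN items {WALL row 1 (19095–19098), U₂ `MinimalTwinBSDTwo`, Q2 `KolyvaginRelationAtTwo`,
PRINT} — to ONE residual F4ᵖᵍ: the off-cut frames whose curve `E` is not multiplicative at `2`, where the LEAD's blanket hypothesis (NPh_K) of
the master halving descent B2Q♭ is FALSE (the Lawson–Wuthrich class `ξ_E ∈ H¹(ℚ, E[2])`, inflated from `ℚ(E[4])`, is an honest class of
`Sel₂(E/ℚ) = Ш(E/ℚ)[2]`; instrument LW2 32/32, T_A/T_B/T_C).  READING the master proof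
(`PlusDescent.exists_primitive_of_two_pow_pred_smul_ne_zero_of_nonPhantom_of_pairSupply`) shows (NPh_K) is consumed EXACTLY ONCE (its `hres`,
level `2^(M+2)`): «no non-zero phantom class lies in the span of `ι₂ s` and `ι₂ y`», `s = res_K s₀` (`τ = +1`, order `2^a`), `y = c_M(1) = δ_M(y_K)`
(`τ = −1`, order `2^κ`).  Over `K` the non-zero phantom classes at every level are `{ι(res_K ξ)}` (tree:
`Lw2PhantomExclusion.eq_zero_or_eq_resTorsion_of_forall_torsionFixing_pow`), so by the `τ`-trick the span condition is THREE inequalities between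
classes of ORDER TWO in `H¹(ℚ, E[2]) = H¹(ℚ, E^d[2])` (`E[2] = E^d[2]` as Galois modules, `res_K` injective since `E(K)[2] = 0`):
`ξ ≠ s♭`, `ξ ≠ π_d`, `ξ ≠ s♭ + π_d`, where `s♭ = 2^(a−1) s₀ ∈ Ш(E)[2]` is OURS TO CHOOSE and `π_d = δ^(E^d)(P_d) ∈ Sel₂(E^d) ∖ 0` is the Kummer
class of the generator of the rank-one twin (`2^(κ−1) y = ι(res_K π_d)`).  Hence the NEW LEVER: the residual splits along ONE 2-ADIC BIT OF THE TWIN,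
    `𝒩(Wd)`: no non-zero class of `Sel₂(Wd)` dies on `Gal(ℚ̄/ℚ(Wd[4]))`   (⟺ `π_d ≠ ξ` ⟺ `P_d ∉ 2·Wd(ℚ(Wd[4]))`),
the rank-ONE analogue of gk2-p4's bit for `E`.  On `𝒩` choose `s♭ ∈ Ш(E)[2] ∖ {0, ξ, ξ + π_d}` (always possible: `Ш(E)[2] ≅ (ℤ/2)²`, and if
`π_d ∈ Ш(E)[2]` take `s♭ = π_d`), lift it to `s₀ ∈ Sel_(2^(a+1))(E)` of order `2^a ≥ 2^(M₀)` (Cassels–Tate: `Ш(E)[2^∞] ≅ (ℤ/2^a)²`, `a ≥ M₀` by the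
LEAD's sharp-class theorem) — then the SPAN-LOCAL master theorem (stub N1 = the master with `hNPh` replaced by its single use `hSpan`) runs VERBATIM
and yields the K₄⁻ witness `n = ℓ` (prime).  On `𝒫 = ¬𝒩` (`π_d = ξ`: the phantom IS the twin's Kummer class; `ξ` capitulates in `K`; by Kramer's
norm index at the ramified prime `ℓ₀` this is `loc_(ℓ₀) ξ = 0`, decided by `Frob_(ℓ₀)` on `E[4]` — hence the name) every allowed Kolyvagin prime
`λ` sees `y` with one bit LESS than full order and the single-prime descent is exactly ONE BIT SHORT (it proves `a ≤ M₀`, which is true): an honest,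
smaller residual (stub P), with its own instrument (kit j341556 «PN-split»: per cell/frame, `𝒫`/`𝒩`, `c_(ℓ₀)(Wd)`, `loc_(ℓ₀) ξ`).

## Stubs (3) and composition
* N1 `stub_B2Q_spanLocal` — the LEAD's master B2Q♭ signature VERBATIM with `hNPh` replaced by `hSpan : SpanNonPhantom …` (its only use). Size S
  (mechanical: delete the `have hres` block, `exact hSpan hdvd2`).
* N2 `stub_spanCleanSharpClass` — on `𝒩`, from `BSD₂(E)`, `BSD₂(Wd)` and one sharp Selmer class, a sharp Selmer class `s₀` at a level `M ≥ M₀+1`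
  satisfying `SpanNonPhantom`. Size M (Cassels–Tate structure of `Ш(E)[2^∞]`, phantom uniqueness over `K`, `τ`-signs, twist transport of `E[2]`).
* P  `stub_offCut_notMultAtTwo_phantomTwin` — K₄⁻ VERBATIM on the off-cut, not-2-multiplicative, `𝒫`-frames. Size L–XL (obstructed for single primes).
* `K4Neg_of_wall_U2_frobeniusSplit : WALL row 1 → U₂ → Q2 → PRINT → K4Neg` — kernel-checked composition; sorries ONLY in the three stubs.
Bookkeeping theorems of LINE 34 v1.5 (`not_hasCM_twin`, `bsdp_of_wallRows`, `onCut_of_wall_U2`, `kFour_shape_offCut_of_nonPhantom`,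
`offCut_of_wall_U2_of_nonPhantom`) are COPIED verbatim (sorry-free) because a Cruxes line module cannot be imported on the farm.
[cite: Kolyvagin1989Izv, Thm. B₂] [cite: McCallumLMS1991, §5 Lemma 5.3, Thm. 5.4] [cite: GrossLMS1991, §4 (4.4)–(4.6), §9] [cite: LawsonWuthrich2016, §3, §7.1, §8]
[cite: Kramer1981, Prop. 4.2–4.3] [cite: GrossZagier1986, V.§2 (2.2)] [cite: Miller2011LMS, Def. 1.1]
-/

set_option autoImplicit false
set_option linter.dupNamespace false
set_option linter.unusedVariables false

noncomputable section

open scoped Classical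

namespace Summit.BirchSwinnertonDyer.BirchSwinnertonDyer.Cruxes.K4Neg.FrobeniusSplit

open WeierstrassCurve NumberField IsDedekindDomain Field Literature.NumberTheory.EllipticCurves
  Literature.NumberTheory.GaloisRepresentations Literature.NumberTheory.EllipticCurves.ModularForms
  Literature.NumberTheory.EllipticCurves.RingClassField
open Summit.BirchSwinnertonDyer.BirchSwinnertonDyer.Theses.GenusKolyvaginAtTwo

/-! ## §0 The two new Props: the twin's 2-adic bit `𝒩`, and the span-local phantom condition -/

/-- **`𝒩(Wd)` — THE TWIN'S 2-ADIC BIT (new object of LINE 37).**  No non-zero class of `Sel₂(Wd/ℚ)` dies on `Gal(ℚ̄/ℚ(Wd[4]))`.  For the rank-one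
`Sel₂`-minimal twin `Wd = E^d` of a cell frame (`Sel₂(Wd) = {0, π_d}`, `π_d = δ(P_d)`) this says `π_d ≠ ξ`, the Lawson–Wuthrich class; equivalently
`P_d ∉ 2·Wd(ℚ(Wd[4]))`; equivalently (card §Chebotarev, Kramer's norm index at `ℓ₀`) `loc_(ℓ₀) ξ ≠ 0`.  Its negation `𝒫` («phantom twin») is the
habitat of the residual stub P. [cite: LawsonWuthrich2016, §7.1] [cite: Kramer1981, Prop. 4.2–4.3] -/
def TwinNonPhantomBit (Wd : WeierstrassCurve ℚ) [Wd.IsElliptic] : Prop :=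
  ∀ x : galH1Torsion Wd ((2 : ℕ) : ℤ), x ∈ selmerGroup Wd ((2 : ℕ) : ℤ) →
    (∀ ρ' ∈ torsionFixing Wd ((4 : ℕ) : ℤ), h1Eval Wd ((2 : ℕ) : ℤ) x ρ' = 0) → x = 0

/-- **`SpanNonPhantom` — the SINGLE use of (NPh_K) in the master halving descent, as a Prop of the frame, the level `M` and the class `s₀`.**
At level `2^(M+2)` over `K`: a class of the span of `ι₂ (res_K s₀)` and `ι₂ c_M(1)` that dies on `Gal(K̄/K(E[2^(M+2)]))` is `0`
(`ι₂ = torsionH1OfDvd`, any proof of `2^M ∣ 2^(M+2)`).  This is LITERALLY the statement `hres` of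
`PlusDescent.exists_primitive_of_two_pow_pred_smul_ne_zero_of_nonPhantom_of_pairSupply` (l.185–190 of the master file). -/
def SpanNonPhantom (W : WeierstrassCurve ℚ) [W.IsElliptic] [W.IsGloballyMinimal] [NeZero (W.conductorNorm ℤ)]
    (K : Type) [Field K] [NumberField K] (Dt : ModularParametrizationData W (W.conductorNorm ℤ)) (β : ℤ) (ι : K →+* ℂ)
    (d₁ : KolyvaginHeegnerData Dt β ι 1) (M : ℕ) (s₀ : galH1Torsion W ((2 ^ M : ℕ) : ℤ)) : Prop :=
  ∀ (hdvd2 : ((2 ^ M : ℕ) : ℤ) ∣ ((2 ^ (M + 2) : ℕ) : ℤ)) (a' b' : ℤ),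
    (∀ ρ' ∈ torsionFixing (W.baseChange K) ((2 ^ (M + 2) : ℕ) : ℤ),
      h1Eval (W.baseChange K) ((2 ^ (M + 2) : ℕ) : ℤ)
        (a' • torsionH1OfDvd (W.baseChange K) hdvd2 (resTorsion W K ((2 ^ M : ℕ) : ℤ) s₀) +
          b' • torsionH1OfDvd (W.baseChange K) hdvd2 (d₁.kolyvaginClass Nat.prime_two M)) ρ' = 0) →
    a' • torsionH1OfDvd (W.baseChange K) hdvd2 (resTorsion W K ((2 ^ M : ℕ) : ℤ) s₀) +
      b' • torsionH1OfDvd (W.baseChange K) hdvd2 (d₁.kolyvaginClass Nat.prime_two M) = 0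

/-! ## §1 Bookkeeping COPIED VERBATIM from LINE 34 v1.5 (`Cruxes/K4Neg/Lines/twin_bsd_road.lean`, commit 89cd124c6b1d) — sorry-free -/

/-- The `Sel₂`-minimal twin of an admissible frame of a non-CM `E` is non-CM (same `j`-invariant). [cite: SilvermanAEC2009, III.1.4(b)] -/
theorem not_hasCM_twin (W : WeierstrassCurve ℚ) [W.IsElliptic] (hcm : ¬ W.HasCM) (K : Type) [Field K] [NumberField K]
    (Wd : WeierstrassCurve ℚ) (hWd : ∃ C : VariableChange ℚ, C • W.quadraticTwist (NumberField.discr K : ℚ) = Wd) : ¬ Wd.HasCM := by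
  obtain ⟨C, hC⟩ := hWd
  have hd : (NumberField.discr K : ℚ) ≠ 0 := Int.cast_ne_zero.mpr (NumberField.discr_ne_zero K)
  haveI := W.isElliptic_quadraticTwist hd
  rw [← hC]
  exact not_hasCM_variableChange _ C (not_hasCM_quadraticTwist W hd hcm)

open Summit.BirchSwinnertonDyer.BirchSwinnertonDyer.Theses.ByReductionTypeAtTwo
  (GoodOrdinaryRankZeroAtTwo MultiplicativeRankZeroAtTwo SupersingularRankZeroAtTwo AdditiveRankZeroAtTwo) in
/-- `BSD₂(E)` for a non-CM rank-`0` curve from the four WALL rows of `ByReductionTypeAtTwo`, by name (LINE 34 §4, verbatim). [cite: Miller2011LMS, Def. 1.1] -/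
theorem bsdp_of_wallRows (hOrd : GoodOrdinaryRankZeroAtTwo) (hMult : MultiplicativeRankZeroAtTwo)
    (hSS : SupersingularRankZeroAtTwo) (hAdd : AdditiveRankZeroAtTwo)
    (W : WeierstrassCurve ℚ) [W.IsElliptic] [W.IsGloballyMinimal] (hcm : ¬ W.HasCM) (hr0 : W.analyticRank = 0) : BSDp W 2 := by
  haveI : Fact (Nat.Prime 2) := ⟨Nat.prime_two⟩
  by_cases hg : W.HasGoodReductionAtPrime 2
  · by_cases hd : ((2 : ℕ) : ℤ) ∣ W.frobeniusTrace 2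
    · exact hSS W hcm hr0 ⟨hg, hd⟩
    · exact hOrd W hcm hr0 ⟨hg, hd⟩
  · by_cases hm : W.HasMultiplicativeReductionAtPrime 2
    · exact hMult W hcm hr0 hm
    · exact hAdd W hcm hr0 ⟨hg, hm⟩

open Summit.BirchSwinnertonDyer.BirchSwinnertonDyer.Theses.ByReductionTypeAtTwo
  (GoodOrdinaryRankZeroAtTwo MultiplicativeRankZeroAtTwo SupersingularRankZeroAtTwo AdditiveRankZeroAtTwo) in
/-- **K₄⁻ ON THE CUT ⟸ WALL row 1 + U₂ + Q2 + PRINT — NO stub (LINE 34 §4, verbatim).** [cite: McCallumLMS1991, §5 Thm. 5.4] [cite: GrossZagier1986, V.§2 (2.2)] -/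
theorem onCut_of_wall_U2 (hOrd : GoodOrdinaryRankZeroAtTwo) (hMult : MultiplicativeRankZeroAtTwo)
    (hSS : SupersingularRankZeroAtTwo) (hAdd : AdditiveRankZeroAtTwo) (hTw : MinimalTwinBSDTwo) (hQ2 : KolyvaginRelationAtTwo)
    (hGZ : GrossZagierAllLevels) (hGZK : MultPublishedInputsAtTwo) (hL : EntireLFunctionRat) (hMi : MilneAnyModel)
    (W : WeierstrassCurve ℚ) [W.IsElliptic] [W.IsGloballyMinimal] [NeZero (W.conductorNorm ℤ)]
    (hcm : ¬ W.HasCM) (hr0 : W.analyticRank = 0) (hρ : ∀ n : ℕ, 0 < n → W.HasSurjectiveModNGaloisRep ((2 : ℤ) ^ n))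
    (hT : Odd W.tamagawaProduct) (hneg : W.Δ < 0) (h4 : Nat.card (W.selmerGroup 2) = 4)
    (v : HeightOneSpectrum (𝓞 ℚ)) (h2v : ((2 : ℕ) : 𝓞 ℚ) ∉ v.asIdeal)
    (hNv : ((W.conductorNorm ℤ : ℕ) : 𝓞 ℚ) ∈ v.asIdeal) (hmult : W.HasMultiplicativeReductionAt v)
    (K : Type) [Field K] [NumberField K] (hIQ : IsImaginaryQuadratic K) (hodd : Odd (NumberField.discr K))
    (h3 : NumberField.discr K ≠ -3) (hHe : SatisfiesHeegnerHypothesis (W.conductorNorm ℤ) K)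
    (hsq1 : ¬ IsSquare ((NumberField.discr K : ℚ) * -|W.Δ|)) (hsq2 : ¬ IsSquare ((NumberField.discr K : ℚ) * (-(2 * |W.Δ|))))
    (ℓ : ℕ) (hℓ : ℓ.Prime) (hdK : NumberField.discr K = -(ℓ : ℤ))
    (h2K : ((Ideal.span {(2 : ℤ)}).primesOver (𝓞 K)).ncard = 2)
    (Dt : ModularParametrizationData W (W.conductorNorm ℤ))
    (hopt : ∀ z ∈ Dt.L.lattice, ∃ w ∈ periodLattice Dt.f, z = (Dt.c : ℂ) * w) (hc : Odd Dt.c)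
    (β : ℤ) (ι : K →+* ℂ) (d₁ : KolyvaginHeegnerData Dt β ι 1) (hy : ¬ IsOfFinAddOrder d₁.derivedPoint)
    (M₀ : ℕ) (hdiv : ∃ Q : (W.baseChange (ringClassField K ι 1)).toAffine.Point, ((2 ^ M₀ : ℕ) : ℤ) • Q = d₁.derivedPoint)
    (hndiv : ¬ ∃ Q : (W.baseChange (ringClassField K ι 1)).toAffine.Point, ((2 ^ (M₀ + 1) : ℕ) : ℤ) • Q = d₁.derivedPoint)
    (hM₀ : 1 ≤ M₀)
    (Wd : WeierstrassCurve ℚ) [Wd.IsElliptic] [Wd.IsGloballyMinimal]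
    (hWd : ∃ C : VariableChange ℚ, C • W.quadraticTwist (NumberField.discr K : ℚ) = Wd)
    (hrd : Wd.analyticRank = 1) (hSel : Nat.card (Wd.selmerGroup 2) = 2) (hDEF : padicValNat 2 Wd.tamagawaProduct ≤ 1) :
    ∃ (n : ℕ) (d : KolyvaginHeegnerData Dt β ι n), Squarefree n ∧
      (∀ ℓ ∈ n.primeFactors, Zhang2014.IsKolyvaginPrime (W.conductorNorm ℤ) W K 2 ℓ ∧ 2 ≤ Zhang2014.kolyvaginIndex W 2 ℓ ∧
        FrobEqFrobInfty W K 2 ℓ) ∧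
      ¬ ∃ Q : (W.baseChange (ringClassField K ι n)).toAffine.Point, (2 : ℤ) • Q = d.derivedPoint := by
  have hBW : BSDp W 2 := bsdp_of_wallRows hOrd hMult hSS hAdd W hcm hr0
  have hBd : BSDp Wd 2 := hTw Wd (not_hasCM_twin W hcm K Wd hWd) hrd hSel
  exact (Summit.BirchSwinnertonDyer.BirchSwinnertonDyer.Theorems.GenusSupplyNarrow.KFourCell.LeafCurrency.kFourNeg_conclusion_iff_bsdp hGZ hL hGZK hMi hQ2 W hcm hr0 hρ hT
    hneg h4 K hIQ hodd h3 hHe hsq1 hsq2 ℓ hℓ hdK h2K Dt hopt hc β ι d₁ hy M₀ hdiv hndiv hM₀ Wd hWd hrd hSel hDEF v h2v hNv hmult hBd).mpr hBW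

/-- **The K₄⁻ SHAPE off the cut from ONE sharp Selmer class, modulo Q2 and (NPh_K)** (LINE 34 §5, verbatim; used on the 2-multiplicative slice only). -/
theorem kFour_shape_offCut_of_nonPhantom (hQ2 : KolyvaginRelationAtTwo)
    (W : WeierstrassCurve ℚ) [W.IsElliptic] [W.IsGloballyMinimal] [NeZero (W.conductorNorm ℤ)] (hcm : ¬ W.HasCM) (hneg : W.Δ < 0)
    (hT : Odd W.tamagawaProduct)
    (K : Type) [Field K] [NumberField K] (hIQ : IsImaginaryQuadratic K) (hodd : Odd (NumberField.discr K))
    (h3 : NumberField.discr K ≠ -3) (hHe : SatisfiesHeegnerHypothesis (W.conductorNorm ℤ) K)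
    (hsq1 : ¬ IsSquare ((NumberField.discr K : ℚ) * -|W.Δ|))
    (hρ : ∀ n : ℕ, 0 < n → W.HasSurjectiveModNGaloisRep ((2 : ℤ) ^ n))
    (hNPh : ∀ (L : ℕ), 1 ≤ L → ∀ z : galH1Torsion (W.baseChange K) ((2 ^ L : ℕ) : ℤ),
      (∀ ρ' ∈ torsionFixing (W.baseChange K) ((2 ^ L : ℕ) : ℤ), h1Eval (W.baseChange K) ((2 ^ L : ℕ) : ℤ) z ρ' = 0) →
      (∀ w : HeightOneSpectrum (𝓞 K), z ∈ selmerLocalKer (W.baseChange K) (w.adicCompletion K) ((2 ^ L : ℕ) : ℤ)) → z = 0)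
    (Dt : ModularParametrizationData W (W.conductorNorm ℤ)) (β : ℤ) (ι : K →+* ℂ) (d₁ : KolyvaginHeegnerData Dt β ι 1) (M₀ : ℕ)
    (hndiv : ¬ ∃ Q : (W.baseChange (ringClassField K ι 1)).toAffine.Point, ((2 ^ (M₀ + 1) : ℕ) : ℤ) • Q = d₁.derivedPoint)
    (hw1 : W.rootNumber = 1)
    (hsharp : ∃ (M : ℕ) (s₀ : galH1Torsion W ((2 ^ M : ℕ) : ℤ)), s₀ ∈ selmerGroup W ((2 ^ M : ℕ) : ℤ) ∧ ((2 ^ (M₀ - 1) : ℕ) : ℤ) • s₀ ≠ 0) :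
    ∃ (n : ℕ) (d : KolyvaginHeegnerData Dt β ι n), Squarefree n ∧
      (∀ ℓ ∈ n.primeFactors, Zhang2014.IsKolyvaginPrime (W.conductorNorm ℤ) W K 2 ℓ ∧ 2 ≤ Zhang2014.kolyvaginIndex W 2 ℓ ∧
        FrobEqFrobInfty W K 2 ℓ) ∧
      ¬ ∃ Q : (W.baseChange (ringClassField K ι n)).toAffine.Point, (2 : ℤ) • Q = d.derivedPoint := by
  haveI : Fact (Nat.Prime 2) := ⟨Nat.prime_two⟩
  obtain ⟨M, s₀, hs₀, hne⟩ := hsharp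
  have hs2 : W.HasSurjectiveModNGaloisRep 2 := by simpa using hρ 1 one_pos
  have hdvd : ((2 ^ M : ℕ) : ℤ) ∣ ((2 ^ (M + M₀ + 1) : ℕ) : ℤ) := by exact_mod_cast pow_dvd_pow 2 (by omega : M ≤ M + M₀ + 1)
  have hinj : Function.Injective (torsionH1OfDvd W hdvd) :=
    Summit.BirchSwinnertonDyer.BirchSwinnertonDyer.Theorems.GenusExact.VisiblePairAtTwo.torsionH1OfDvd_pow_injective W (p := 2)
      (Summit.BirchSwinnertonDyer.BirchSwinnertonDyer.Theorems.GenusExact.VisiblePairAtTwo.torsionBy_two_eq_bot_of_surj W hs2) hdvd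
  have hs₀' : torsionH1OfDvd W hdvd s₀ ∈ selmerGroup W ((2 ^ (M + M₀ + 1) : ℕ) : ℤ) := torsionH1OfDvd_mem_selmerGroup W hdvd hs₀
  have hne' : ((2 ^ (M₀ - 1) : ℕ) : ℤ) • torsionH1OfDvd W hdvd s₀ ≠ 0 := fun h ↦
    hne (hinj (by rw [map_zsmul, map_zero, h]))
  obtain ⟨ℓ, d, hkol, hidx, hF, -, -, -, hwit⟩ :=
    Summit.BirchSwinnertonDyer.BirchSwinnertonDyer.Theorems.GenusExact.PlusDescent.exists_primitive_of_two_pow_pred_smul_ne_zero_of_nonPhantom_of_pairSupply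
      (fun ℓ ↦ FrobEqFrobInfty W K 2 ℓ) hQ2 W hcm hT K hIQ hodd h3 hHe hρ hNPh Dt β ι d₁ M₀ hndiv hw1
      (Summit.BirchSwinnertonDyer.BirchSwinnertonDyer.Theorems.GenusExact.PlusDescent.pairSupply_frobEqFrobInfty_of_Δ_neg W hcm hneg K hIQ hsq1 hρ)
      (M + M₀ + 1) (by omega) _ hs₀' hne'
  have hℓp : ℓ.Prime := hkol.1
  refine ⟨1 * ℓ, d, by rw [one_mul]; exact hℓp.squarefree, fun q hq ↦ ?_, hwit⟩
  rw [one_mul, hℓp.primeFactors, Finset.mem_singleton] at hq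
  subst hq
  exact ⟨hkol, le_trans (by omega) hidx, hF⟩

open Summit.BirchSwinnertonDyer.BirchSwinnertonDyer.Theses.ByReductionTypeAtTwo
  (GoodOrdinaryRankZeroAtTwo MultiplicativeRankZeroAtTwo SupersingularRankZeroAtTwo AdditiveRankZeroAtTwo) in
/-- **K₄⁻ AT AN OFF-CUT FRAME ⟸ WALL row 1 + U₂ + Q2 + PRINT + (NPh_K)** (LINE 34 §5, verbatim; used on the 2-multiplicative slice, where gk2-p5
supplies (NPh_K)). [cite: GrossZagier1986, V.§2 (2.2)] [cite: McCallumLMS1991, §5 Thm. 5.4] [cite: LawsonWuthrich2016, §7.1] -/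
theorem offCut_of_wall_U2_of_nonPhantom (hOrd : GoodOrdinaryRankZeroAtTwo) (hMult : MultiplicativeRankZeroAtTwo)
    (hSS : SupersingularRankZeroAtTwo) (hAdd : AdditiveRankZeroAtTwo) (hTw : MinimalTwinBSDTwo) (hQ2 : KolyvaginRelationAtTwo)
    (hGZ : GrossZagierAllLevels) (hGZK : MultPublishedInputsAtTwo) (hL : EntireLFunctionRat) (hMi : MilneAnyModel)
    (W : WeierstrassCurve ℚ) [W.IsElliptic] [W.IsGloballyMinimal] [NeZero (W.conductorNorm ℤ)]
    (hcm : ¬ W.HasCM) (hr0 : W.analyticRank = 0) (hρ : ∀ n : ℕ, 0 < n → W.HasSurjectiveModNGaloisRep ((2 : ℤ) ^ n))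
    (hT : Odd W.tamagawaProduct) (hneg : W.Δ < 0) (h4 : Nat.card (W.selmerGroup 2) = 4)
    (hoff : ¬ ∃ v : HeightOneSpectrum (𝓞 ℚ), ((2 : ℕ) : 𝓞 ℚ) ∉ v.asIdeal ∧ ((W.conductorNorm ℤ : ℕ) : 𝓞 ℚ) ∈ v.asIdeal ∧
      W.HasMultiplicativeReductionAt v)
    (K : Type) [Field K] [NumberField K] (hIQ : IsImaginaryQuadratic K) (hodd : Odd (NumberField.discr K))
    (h3 : NumberField.discr K ≠ -3) (hHe : SatisfiesHeegnerHypothesis (W.conductorNorm ℤ) K)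
    (hsq1 : ¬ IsSquare ((NumberField.discr K : ℚ) * -|W.Δ|)) (hsq2 : ¬ IsSquare ((NumberField.discr K : ℚ) * (-(2 * |W.Δ|))))
    (ℓ : ℕ) (hℓ : ℓ.Prime) (hdK : NumberField.discr K = -(ℓ : ℤ))
    (h2K : ((Ideal.span {(2 : ℤ)}).primesOver (𝓞 K)).ncard = 2)
    (Dt : ModularParametrizationData W (W.conductorNorm ℤ))
    (hopt : ∀ z ∈ Dt.L.lattice, ∃ w ∈ periodLattice Dt.f, z = (Dt.c : ℂ) * w) (hc : Odd Dt.c)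
    (β : ℤ) (ι : K →+* ℂ) (d₁ : KolyvaginHeegnerData Dt β ι 1) (hy : ¬ IsOfFinAddOrder d₁.derivedPoint)
    (M₀ : ℕ) (hdiv : ∃ Q : (W.baseChange (ringClassField K ι 1)).toAffine.Point, ((2 ^ M₀ : ℕ) : ℤ) • Q = d₁.derivedPoint)
    (hndiv : ¬ ∃ Q : (W.baseChange (ringClassField K ι 1)).toAffine.Point, ((2 ^ (M₀ + 1) : ℕ) : ℤ) • Q = d₁.derivedPoint)
    (hM₀ : 1 ≤ M₀)
    (Wd : WeierstrassCurve ℚ) [Wd.IsElliptic] [Wd.IsGloballyMinimal]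
    (hWd : ∃ C : VariableChange ℚ, C • W.quadraticTwist (NumberField.discr K : ℚ) = Wd)
    (hrd : Wd.analyticRank = 1) (hSel : Nat.card (Wd.selmerGroup 2) = 2) (hDEF : padicValNat 2 Wd.tamagawaProduct ≤ 1)
    (hNPh : ∀ (L : ℕ), 1 ≤ L → ∀ z : galH1Torsion (W.baseChange K) ((2 ^ L : ℕ) : ℤ),
      (∀ ρ' ∈ torsionFixing (W.baseChange K) ((2 ^ L : ℕ) : ℤ), h1Eval (W.baseChange K) ((2 ^ L : ℕ) : ℤ) z ρ' = 0) →
      (∀ w : HeightOneSpectrum (𝓞 K), z ∈ selmerLocalKer (W.baseChange K) (w.adicCompletion K) ((2 ^ L : ℕ) : ℤ)) → z = 0) :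
    ∃ (n : ℕ) (d : KolyvaginHeegnerData Dt β ι n), Squarefree n ∧
      (∀ ℓ ∈ n.primeFactors, Zhang2014.IsKolyvaginPrime (W.conductorNorm ℤ) W K 2 ℓ ∧ 2 ≤ Zhang2014.kolyvaginIndex W 2 ℓ ∧
        FrobEqFrobInfty W K 2 ℓ) ∧
      ¬ ∃ Q : (W.baseChange (ringClassField K ι n)).toAffine.Point, (2 : ℤ) • Q = d.derivedPoint := by
  haveI : Fact (Nat.Prime 2) := ⟨Nat.prime_two⟩
  have hs2 : W.HasSurjectiveModNGaloisRep 2 := by simpa using hρ 1 one_pos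
  have hw : W.rootNumber = 1 :=
    (Literature.Barriers.BirchSwinnertonDyer.even_analyticRank_iff_of_isNewformOf_conductorLevel Dt.isNewformOf).mp
      (by rw [hr0]; exact Even.zero)
  have hrk0 : W.mordellWeilRank = 0 := by rw [(hGZK W (by rw [hr0]; exact zero_le_one)).1, hr0]
  have hBW : BSDp W 2 := bsdp_of_wallRows hOrd hMult hSS hAdd W hcm hr0
  have hBd : BSDp Wd 2 := hTw Wd (not_hasCM_twin W hcm K Wd hWd) hrd hSel
  have hpow :=
    Summit.BirchSwinnertonDyer.BirchSwinnertonDyer.Theorems.GenusSupplyNarrow.Lossless.natCard_primaryComponent_sha_baseChange_two_eq_pow_of_bsdp_pair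
      hGZ hL hGZK hMi W hs2 hT hr0 K hIQ hodd h3 hHe Dt hc β ι d₁ M₀ hdiv hndiv Wd hWd hrd hBW hBd
  obtain ⟨k, a, ha, hka, hne⟩ :=
    Summit.BirchSwinnertonDyer.BirchSwinnertonDyer.Theorems.GenusExact.PlusDescent.exists_mem_sha_two_pow_pred_smul_ne_zero_of_natCard_eq_pow
      W K hT hIQ hodd hHe hs2 Dt β ι d₁ hy M₀ hM₀ hndiv hw hrk0 Wd hWd hSel (Or.inl ⟨hneg, hDEF⟩) hpow
  rcases Nat.eq_zero_or_pos k with rfl | hkpos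
  · rw [pow_zero, Nat.cast_one, one_zsmul] at hka
    exact (hne (by rw [hka, zsmul_zero])).elim
  · have hn : ((2 ^ k : ℕ) : ℤ) ≠ 0 := by positivity
    have hmem : a ∈ W.sha ⊓ AddSubgroup.torsionBy W.galH1 ((2 ^ k : ℕ) : ℤ) :=
      AddSubgroup.mem_inf.mpr ⟨ha, by change ((2 ^ k : ℕ) : ℤ) • a = 0; exact hka⟩
    rw [← WeierstrassCurve.map_torsionH1ToH1_selmerGroup_holds W hn] at hmem
    obtain ⟨x, hx, rfl⟩ := AddSubgroup.mem_map.mp hmem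
    have hne' : ((2 ^ (M₀ - 1) : ℕ) : ℤ) • x ≠ 0 := fun h ↦ hne (by rw [← map_zsmul, h, map_zero])
    exact kFour_shape_offCut_of_nonPhantom hQ2 W hcm hneg hT K hIQ hodd h3 hHe hsq1 hρ hNPh Dt β ι d₁ M₀ hndiv hw ⟨k, x, hx, hne'⟩

/-! ## §2 The three stubs of LINE 37 -/

/-- **N1 `stub_B2Q_spanLocal` — THE SPAN-LOCAL MASTER THEOREM (stub; size S, mechanical).**  The LEAD's B2Q♭
`PlusDescent.exists_primitive_of_two_pow_pred_smul_ne_zero_of_nonPhantom_of_pairSupply` with its signature VERBATIM except that the blanket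
hypothesis `hNPh` ((NPh_K) at every level for every Selmer class) is REPLACED by `hSpan : SpanNonPhantom W K Dt β ι d₁ M s₀` — which is, up to
proof irrelevance of the divisibility witness, EXACTLY the `have hres` of the master proof (its lines 185–190), the ONLY place `hNPh` is used.
PROOF FOR THE PROVER: copy the master proof, delete the `have hres … := by …` block and pass `hSpan hdvd2` where `hres` was passed to `hPair`.
Why it might fail: it cannot (the master proof is kernel-checked; this is a re-cut of its hypotheses), unless the master file changes.
Honours `Disproof`-type obstructions trivially (no new mathematics).  [cite: McCallumLMS1991, §5 Lemma 5.3, Thm. 5.4] [cite: Kolyvagin1989Izv, Thm. B₂, §3]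
[cite: GrossLMS1991, §4 (4.4)–(4.6)] -/
theorem stub_B2Q_spanLocal (Φ : ℕ → Prop)
    (hQ2 : KolyvaginRelationAtTwo)
    (W : WeierstrassCurve ℚ) [W.IsElliptic] [W.IsGloballyMinimal] [NeZero (W.conductorNorm ℤ)] (hcm : ¬ W.HasCM)
    (hT : Odd W.tamagawaProduct)
    (K : Type) [Field K] [NumberField K] (hIQ : IsImaginaryQuadratic K) (hodd : Odd (NumberField.discr K))
    (h3 : NumberField.discr K ≠ -3) (hHe : SatisfiesHeegnerHypothesis (W.conductorNorm ℤ) K)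
    (hρ : ∀ n : ℕ, 0 < n → W.HasSurjectiveModNGaloisRep ((2 : ℤ) ^ n))
    (Dt : ModularParametrizationData W (W.conductorNorm ℤ)) (β : ℤ) (ι : K →+* ℂ) (d₁ : KolyvaginHeegnerData Dt β ι 1) (M₀ : ℕ)
    (hndiv : ¬ ∃ Q : (W.baseChange (ringClassField K ι 1)).toAffine.Point, ((2 ^ (M₀ + 1) : ℕ) : ℤ) • Q = d₁.derivedPoint)
    (hw1 : W.rootNumber = 1)
    (hPair : ∀ (n : ℕ) (c : K ≃ₐ[ℚ] K), c ≠ 1 →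
      ∀ (x y : galH1Torsion (W.baseChange K) ((2 ^ (n + 1) : ℕ) : ℤ)) (ex ey : ℕ), 1 ≤ ex → 1 ≤ ey →
      addOrderOf x = 2 ^ ex → addOrderOf y = 2 ^ ey →
      ∀ (sx sy : ℤ), (sx = 1 ∨ sx = -1) → (sy = 1 ∨ sy = -1) →
      conjAct W c ((2 ^ (n + 1) : ℕ) : ℤ) x = sx • x → conjAct W c ((2 ^ (n + 1) : ℕ) : ℤ) y = sy • y →
      (∀ a b : ℤ, (∀ ρ ∈ torsionFixing (W.baseChange K) ((2 ^ (n + 1) : ℕ) : ℤ),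
          h1Eval (W.baseChange K) ((2 ^ (n + 1) : ℕ) : ℤ) (a • x + b • y) ρ = 0) → a • x + b • y = 0) →
      ∃ ℓ : ℕ, Zhang2014.IsKolyvaginPrime (W.conductorNorm ℤ) W K 2 ℓ ∧ n + 1 ≤ Zhang2014.kolyvaginIndex W 2 ℓ ∧ Φ ℓ ∧
        (∃ (v : HeightOneSpectrum (𝓞 ℚ)) (𝔓 : Ideal (absIntegers (𝓞 ℚ) ℚ)) (h c₀ : absoluteGaloisGroup ℚ),
          (ℓ : 𝓞 ℚ) ∈ v.asIdeal ∧ 𝔓 ∈ v.primesAbove ∧ IsArithFrobAt (𝓞 ℚ) h 𝔓 ∧ IsComplexConjugation (Rat.castHom ℝ) c₀ ∧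
          (∀ X : geomTorsion W ((2 ^ (n + 1) : ℕ) : ℤ), h • h • X = X) ∧
          (∃ u : geomTorsion W ((2 : ℕ) : ℤ), h • u ≠ u) ∧
          ∀ (e : K →ₐ[ℚ] AlgebraicClosure ℚ) (z : K), h • e z = c₀ • e z) ∧
        ∀ w : HeightOneSpectrum (𝓞 K), (ℓ : 𝓞 K) ∈ w.asIdeal →
          (∀ j : ℕ, ((2 ^ j : ℕ) : ℤ) • x ∈ (W.baseChange K).torsionLocalKer (w.adicCompletion K) ((2 ^ (n + 1) : ℕ) : ℤ) ↔ ex ≤ j) ∧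
          (∀ j : ℕ, ((2 ^ j : ℕ) : ℤ) • y ∈ (W.baseChange K).torsionLocalKer (w.adicCompletion K) ((2 ^ (n + 1) : ℕ) : ℤ) ↔ ey ≤ j))
    (M : ℕ) (hM₀M : M₀ + 1 ≤ M) (s₀ : galH1Torsion W ((2 ^ M : ℕ) : ℤ)) (hs₀ : s₀ ∈ selmerGroup W ((2 ^ M : ℕ) : ℤ))
    (hne : ((2 ^ (M₀ - 1) : ℕ) : ℤ) • s₀ ≠ 0)
    (hSpan : SpanNonPhantom W K Dt β ι d₁ M s₀) :
    ∃ (ℓ : ℕ) (d : KolyvaginHeegnerData Dt β ι (1 * ℓ)),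
      Zhang2014.IsKolyvaginPrime (W.conductorNorm ℤ) W K 2 ℓ ∧ M + 2 ≤ Zhang2014.kolyvaginIndex W 2 ℓ ∧ Φ ℓ ∧
      (∃ (v : HeightOneSpectrum (𝓞 ℚ)) (𝔓 : Ideal (absIntegers (𝓞 ℚ) ℚ)) (h c₀ : absoluteGaloisGroup ℚ),
          (ℓ : 𝓞 ℚ) ∈ v.asIdeal ∧ 𝔓 ∈ v.primesAbove ∧ IsArithFrobAt (𝓞 ℚ) h 𝔓 ∧ IsComplexConjugation (Rat.castHom ℝ) c₀ ∧
          (∀ X : geomTorsion W ((2 ^ (M + 2) : ℕ) : ℤ), h • h • X = X) ∧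
          (∃ u : geomTorsion W ((2 : ℕ) : ℤ), h • u ≠ u) ∧
          ∀ (e : K →ₐ[ℚ] AlgebraicClosure ℚ) (z : K), h • e z = c₀ • e z) ∧
      (∀ s ∈ d₁.S, ∃ s' ∈ d.S, ∀ (x : ringClassField K ι 1) (x' : ringClassField K ι (1 * ℓ)),
          (x : ℂ) = x' → ((s' x' : ringClassField K ι (1 * ℓ)) : ℂ) = (s x : ℂ)) ∧
      (∀ (x : ringClassField K ι 1) (x' : ringClassField K ι (1 * ℓ)), (x : ℂ) = x' → d.emb x' = d₁.emb x) ∧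
      ¬ ∃ Q : (W.baseChange (ringClassField K ι (1 * ℓ))).toAffine.Point, (2 : ℤ) • Q = d.derivedPoint := by
  sorry

/-- **N2 `stub_spanCleanSharpClass` — THE PHANTOM-AVOIDING SHARP CLASS ON `𝒩` (stub; size M; the load-bearing NEW lemma of the line).**
For a K₄⁻ frame (binders VERBATIM, off the cut) with `BSD₂(E)`, `BSD₂(Wd)` (from WALL row 1 / U₂ in the composition), the bit `𝒩(Wd)` and ONE
sharp Selmer class (`2^(M₀−1) • x ≠ 0`, supplied by the LEAD's pair ledger in the composition), there is a level `M ≥ M₀ + 1` and a sharp class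
`s₀ ∈ Sel_(2^M)(E/ℚ)` whose span with `c_M(1)` two levels up contains no non-zero phantom class.  PROOF SKETCH (card §N2): (a) `Ш(E/ℚ)[2^∞] ≅ (ℤ/2^a)²`
with `a ≥ M₀` (Cassels–Tate alternating + the given sharp class; rank `0` so `Sel_(2^k)(E/ℚ) = Ш[2^k]`); (b) `2^(κ−1) c_M(1) = ι(res_K π_d)`,
`π_d = δ(P_d)` the generator class of `Sel₂(Wd) = {0, π_d}` transported through `E^d[2] = E[2]` (`y_K = 2^(M₀)·odd·P₀`, `E(K)⁻/tors = E^d(ℚ)/tors`);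
(c) choose `s♭ ∈ Ш(E)[2] ∖ {0, ξ, ξ + π_d}` (`#Ш(E)[2] = 4`; if `π_d ∈ Ш(E)[2]` take `s♭ = π_d`, else either element `≠ ξ`), `s₀` of order `2^a` above it at
level `M = a + 1`; (d) a non-zero phantom class over `K` at level `2^(M+2)` is `ι(res_K ξ)` (tree `Lw2PhantomExclusion.eq_zero_or_eq_resTorsion_of_forall_torsionFixing_pow`);
if `ι(res_K ξ) = a'·ι₂ s + b'·ι₂ y`, apply `τ` (`s ↦ s`, `y ↦ −y`, `KolyvaginClassSign.sign_conjAct_kolyvaginClass_two`): `2b'·y = 0`, so `b'·ι₂y ∈ {0, ι(res_K π_d)}`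
and `a'·ι₂ s ∈ {ι res_K ξ, ι res_K (ξ + π_d)}` has order `≤ 2`, i.e. `∈ {0, ι res_K s♭}` — each of the four cases is one of `ξ = s♭`, `ξ = π_d` (¬𝒩),
`ξ = s♭ + π_d`, `ξ = 0`, all excluded (`res_K` injective on `H¹(ℚ, E[2])` since `E(K)[2] = 0`).  If `ξ ∉ Sel₂(E)` (e.g. on the cut) the choice in (c) is
free.  Why it might fail: (b)'s transport `2^(κ−1) c_M(1) = ι res_K δ(P_d)` needs the odd-index identification `E(K)⁻ = E^d(ℚ)` and Manin/`u_K`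
bookkeeping at `2` (all odd on the cell: `hc`, `h3`); (a) needs Cassels–Tate for `E/ℚ` (tree: CasselsTateAlternating) — no analytic input.
[cite: LawsonWuthrich2016, §3 Lemma 6, §7.1] [cite: GrossLMS1991, §4 (4.4), §9 Prop. 9.1] [cite: Cassels1962IV, Thm. 1.1] [cite: Kramer1981, Thm. 1] -/
theorem stub_spanCleanSharpClass
    (W : WeierstrassCurve ℚ) [W.IsElliptic] [W.IsGloballyMinimal] [NeZero (W.conductorNorm ℤ)]
    (hcm : ¬ W.HasCM) (hr0 : W.analyticRank = 0) (hρ : ∀ n : ℕ, 0 < n → W.HasSurjectiveModNGaloisRep ((2 : ℤ) ^ n))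
    (hT : Odd W.tamagawaProduct) (hneg : W.Δ < 0) (h4 : Nat.card (W.selmerGroup 2) = 4)
    (hoff : ¬ ∃ v : HeightOneSpectrum (𝓞 ℚ), ((2 : ℕ) : 𝓞 ℚ) ∉ v.asIdeal ∧ ((W.conductorNorm ℤ : ℕ) : 𝓞 ℚ) ∈ v.asIdeal ∧
      W.HasMultiplicativeReductionAt v)
    (K : Type) [Field K] [NumberField K] (hIQ : IsImaginaryQuadratic K) (hodd : Odd (NumberField.discr K))
    (h3 : NumberField.discr K ≠ -3) (hHe : SatisfiesHeegnerHypothesis (W.conductorNorm ℤ) K)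
    (hsq1 : ¬ IsSquare ((NumberField.discr K : ℚ) * -|W.Δ|)) (hsq2 : ¬ IsSquare ((NumberField.discr K : ℚ) * (-(2 * |W.Δ|))))
    (ℓ : ℕ) (hℓ : ℓ.Prime) (hdK : NumberField.discr K = -(ℓ : ℤ))
    (h2K : ((Ideal.span {(2 : ℤ)}).primesOver (𝓞 K)).ncard = 2)
    (Dt : ModularParametrizationData W (W.conductorNorm ℤ))
    (hopt : ∀ z ∈ Dt.L.lattice, ∃ w ∈ periodLattice Dt.f, z = (Dt.c : ℂ) * w) (hc : Odd Dt.c)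
    (β : ℤ) (ι : K →+* ℂ) (d₁ : KolyvaginHeegnerData Dt β ι 1) (hy : ¬ IsOfFinAddOrder d₁.derivedPoint)
    (M₀ : ℕ) (hdiv : ∃ Q : (W.baseChange (ringClassField K ι 1)).toAffine.Point, ((2 ^ M₀ : ℕ) : ℤ) • Q = d₁.derivedPoint)
    (hndiv : ¬ ∃ Q : (W.baseChange (ringClassField K ι 1)).toAffine.Point, ((2 ^ (M₀ + 1) : ℕ) : ℤ) • Q = d₁.derivedPoint)
    (hM₀ : 1 ≤ M₀)
    (Wd : WeierstrassCurve ℚ) [Wd.IsElliptic] [Wd.IsGloballyMinimal]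
    (hWd : ∃ C : VariableChange ℚ, C • W.quadraticTwist (NumberField.discr K : ℚ) = Wd)
    (hrd : Wd.analyticRank = 1) (hSel : Nat.card (Wd.selmerGroup 2) = 2) (hDEF : padicValNat 2 Wd.tamagawaProduct ≤ 1)
    (hBW : BSDp W 2) (hBd : BSDp Wd 2) (hN : TwinNonPhantomBit Wd)
    (hsharp : ∃ (k : ℕ) (x : galH1Torsion W ((2 ^ k : ℕ) : ℤ)), x ∈ selmerGroup W ((2 ^ k : ℕ) : ℤ) ∧ ((2 ^ (M₀ - 1) : ℕ) : ℤ) • x ≠ 0) :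
    ∃ (M : ℕ) (s₀ : galH1Torsion W ((2 ^ M : ℕ) : ℤ)), M₀ + 1 ≤ M ∧ s₀ ∈ selmerGroup W ((2 ^ M : ℕ) : ℤ) ∧
      ((2 ^ (M₀ - 1) : ℕ) : ℤ) • s₀ ≠ 0 ∧ SpanNonPhantom W K Dt β ι d₁ M s₀ := by
  sorry

/-- **P `stub_offCut_notMultAtTwo_phantomTwin` — THE PHANTOM-TWIN RESIDUAL (stub; size L–XL; rank 3 of the line).**  K₄⁻ VERBATIM on the off-cut,
not-2-multiplicative cell frames whose twin bit FAILS: `𝒫 = ¬𝒩(Wd)`, i.e. `δ(P_d) = ξ` — the Lawson–Wuthrich class of `E` is the Kummer class of the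
twin's generator; `ξ` capitulates in `K`; `P_d ∈ 2·Wd(ℚ(E[4]))`.  STRUCTURE (card §P): `𝒫 ⟺ loc_(ℓ₀) ξ = 0` (Kramer's norm index at the ramified good
prime `ℓ₀`; `E ≅ E^d` over `ℚ₂` as `−ℓ₀ ≡ 1 (8)` and over `ℚ_p`, `p ∣ N`; `H¹(ℝ, E[2]) = 0` for `Δ < 0`), so `𝒫` is forced when `Frob_(ℓ₀)` has order `3`
on `E[2]` (`c_(ℓ₀)(Wd) = 1`) and is one Čebotarev half when it is a transposition (`c_(ℓ₀)(Wd) = 2`; always so on the `sf(Δ) = −3` supersingular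
habitat).  OBSTRUCTION (honest): on `𝒫` every allowed Kolyvagin prime `λ` (`Frob_λ = τ`, so `Frob_λ² = 1` on `E[4]`) has `loc_λ y` of order `2^(κ−1)`,
not `2^κ` (`2^(κ−1) y = ι res_K ξ` restricts to `0` at `λ`), and re-running B2Q♭ with that threshold proves only `a ≤ M₀` — ONE BIT SHORT of the
contradiction; a witness with `n` PRIME is not produced by any descent in the tree.  Candidate mechanisms (LINE 38): a TWO-prime witness `n = ℓ₁ℓ₂`
steered by the Cassels–Tate pairing against `ξ` (the bottom of the halved `ℓ₁`-class pairs to `1` with `ξ`, hence is `η` or `ξ+η`, visible to `λ₂`),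
or Mazur visibility of `ξ` in `E × E^d`.  Why it might fail: as K₄⁻ itself (Kolyvagin's conjecture at `2`, `ord₂`-sharp) on this class; the two-prime
relation at `p = 2` needs Q2 at composite conductor.  Instrument: kit j341556 «PN-split» (is `𝒫` populated as predicted; `c_(ℓ₀)`; agreement with
`loc_(ℓ₀) ξ = 0`). [cite: Kolyvagin1989Izv, Thm. B₂, Thm. C] [cite: Kramer1981, Prop. 4.2–4.3] [cite: LawsonWuthrich2016, §7.1, §8] [cite: CremonaMazur2000, §3] -/
theorem stub_offCut_notMultAtTwo_phantomTwin
    (W : WeierstrassCurve ℚ) [W.IsElliptic] [W.IsGloballyMinimal] [NeZero (W.conductorNorm ℤ)]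
    (hcm : ¬ W.HasCM) (hr0 : W.analyticRank = 0) (hρ : ∀ n : ℕ, 0 < n → W.HasSurjectiveModNGaloisRep ((2 : ℤ) ^ n))
    (hT : Odd W.tamagawaProduct) (hneg : W.Δ < 0) (h4 : Nat.card (W.selmerGroup 2) = 4)
    (hoff : ¬ ∃ v : HeightOneSpectrum (𝓞 ℚ), ((2 : ℕ) : 𝓞 ℚ) ∉ v.asIdeal ∧ ((W.conductorNorm ℤ : ℕ) : 𝓞 ℚ) ∈ v.asIdeal ∧
      W.HasMultiplicativeReductionAt v)
    (hnm2 : ¬ ∃ v₂ : HeightOneSpectrum (𝓞 ℚ), ((2 : ℕ) : 𝓞 ℚ) ∈ v₂.asIdeal ∧ W.HasMultiplicativeReductionAt v₂)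
    (K : Type) [Field K] [NumberField K] (hIQ : IsImaginaryQuadratic K) (hodd : Odd (NumberField.discr K))
    (h3 : NumberField.discr K ≠ -3) (hHe : SatisfiesHeegnerHypothesis (W.conductorNorm ℤ) K)
    (hsq1 : ¬ IsSquare ((NumberField.discr K : ℚ) * -|W.Δ|)) (hsq2 : ¬ IsSquare ((NumberField.discr K : ℚ) * (-(2 * |W.Δ|))))
    (ℓ : ℕ) (hℓ : ℓ.Prime) (hdK : NumberField.discr K = -(ℓ : ℤ))
    (h2K : ((Ideal.span {(2 : ℤ)}).primesOver (𝓞 K)).ncard = 2)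
    (Dt : ModularParametrizationData W (W.conductorNorm ℤ))
    (hopt : ∀ z ∈ Dt.L.lattice, ∃ w ∈ periodLattice Dt.f, z = (Dt.c : ℂ) * w) (hc : Odd Dt.c)
    (β : ℤ) (ι : K →+* ℂ) (d₁ : KolyvaginHeegnerData Dt β ι 1) (hy : ¬ IsOfFinAddOrder d₁.derivedPoint)
    (M₀ : ℕ) (hdiv : ∃ Q : (W.baseChange (ringClassField K ι 1)).toAffine.Point, ((2 ^ M₀ : ℕ) : ℤ) • Q = d₁.derivedPoint)
    (hndiv : ¬ ∃ Q : (W.baseChange (ringClassField K ι 1)).toAffine.Point, ((2 ^ (M₀ + 1) : ℕ) : ℤ) • Q = d₁.derivedPoint)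
    (hM₀ : 1 ≤ M₀)
    (Wd : WeierstrassCurve ℚ) [Wd.IsElliptic] [Wd.IsGloballyMinimal]
    (hWd : ∃ C : VariableChange ℚ, C • W.quadraticTwist (NumberField.discr K : ℚ) = Wd)
    (hrd : Wd.analyticRank = 1) (hSel : Nat.card (Wd.selmerGroup 2) = 2) (hDEF : padicValNat 2 Wd.tamagawaProduct ≤ 1)
    (hP : ¬ TwinNonPhantomBit Wd) :
    ∃ (n : ℕ) (d : KolyvaginHeegnerData Dt β ι n), Squarefree n ∧
      (∀ ℓ ∈ n.primeFactors, Zhang2014.IsKolyvaginPrime (W.conductorNorm ℤ) W K 2 ℓ ∧ 2 ≤ Zhang2014.kolyvaginIndex W 2 ℓ ∧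
        FrobEqFrobInfty W K 2 ℓ) ∧
      ¬ ∃ Q : (W.baseChange (ringClassField K ι n)).toAffine.Point, (2 : ℤ) • Q = d.derivedPoint := by
  sorry

/-! ## §3 The `𝒩`-engine: K₄⁻ shape from a span-clean sharp class (sorry-free given N1) -/

/-- **The K₄⁻ SHAPE from ONE span-clean sharp Selmer class, modulo Q2** — the LEAD's packaging with (NPh_K) replaced by `SpanNonPhantom`;
proof = N1 + `pairSupply_frobEqFrobInfty_of_Δ_neg` + bookkeeping (verbatim pattern of LINE 34's `kFour_shape_offCut_of_nonPhantom`). -/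
theorem kFour_shape_of_spanLocal (hQ2 : KolyvaginRelationAtTwo)
    (W : WeierstrassCurve ℚ) [W.IsElliptic] [W.IsGloballyMinimal] [NeZero (W.conductorNorm ℤ)] (hcm : ¬ W.HasCM) (hneg : W.Δ < 0)
    (hT : Odd W.tamagawaProduct)
    (K : Type) [Field K] [NumberField K] (hIQ : IsImaginaryQuadratic K) (hodd : Odd (NumberField.discr K))
    (h3 : NumberField.discr K ≠ -3) (hHe : SatisfiesHeegnerHypothesis (W.conductorNorm ℤ) K)
    (hsq1 : ¬ IsSquare ((NumberField.discr K : ℚ) * -|W.Δ|))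
    (hρ : ∀ n : ℕ, 0 < n → W.HasSurjectiveModNGaloisRep ((2 : ℤ) ^ n))
    (Dt : ModularParametrizationData W (W.conductorNorm ℤ)) (β : ℤ) (ι : K →+* ℂ) (d₁ : KolyvaginHeegnerData Dt β ι 1) (M₀ : ℕ)
    (hndiv : ¬ ∃ Q : (W.baseChange (ringClassField K ι 1)).toAffine.Point, ((2 ^ (M₀ + 1) : ℕ) : ℤ) • Q = d₁.derivedPoint)
    (hw1 : W.rootNumber = 1)
    (M : ℕ) (hM₀M : M₀ + 1 ≤ M) (s₀ : galH1Torsion W ((2 ^ M : ℕ) : ℤ)) (hs₀ : s₀ ∈ selmerGroup W ((2 ^ M : ℕ) : ℤ))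
    (hne : ((2 ^ (M₀ - 1) : ℕ) : ℤ) • s₀ ≠ 0) (hSpan : SpanNonPhantom W K Dt β ι d₁ M s₀) :
    ∃ (n : ℕ) (d : KolyvaginHeegnerData Dt β ι n), Squarefree n ∧
      (∀ ℓ ∈ n.primeFactors, Zhang2014.IsKolyvaginPrime (W.conductorNorm ℤ) W K 2 ℓ ∧ 2 ≤ Zhang2014.kolyvaginIndex W 2 ℓ ∧
        FrobEqFrobInfty W K 2 ℓ) ∧
      ¬ ∃ Q : (W.baseChange (ringClassField K ι n)).toAffine.Point, (2 : ℤ) • Q = d.derivedPoint := by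
  haveI : Fact (Nat.Prime 2) := ⟨Nat.prime_two⟩
  obtain ⟨ℓ, d, hkol, hidx, hF, -, -, -, hwit⟩ :=
    stub_B2Q_spanLocal (fun ℓ ↦ FrobEqFrobInfty W K 2 ℓ) hQ2 W hcm hT K hIQ hodd h3 hHe hρ Dt β ι d₁ M₀ hndiv hw1
      (Summit.BirchSwinnertonDyer.BirchSwinnertonDyer.Theorems.GenusExact.PlusDescent.pairSupply_frobEqFrobInfty_of_Δ_neg W hcm hneg K hIQ hsq1 hρ)
      M hM₀M s₀ hs₀ hne hSpan
  have hℓp : ℓ.Prime := hkol.1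
  refine ⟨1 * ℓ, d, by rw [one_mul]; exact hℓp.squarefree, fun q hq ↦ ?_, hwit⟩
  rw [one_mul, hℓp.primeFactors, Finset.mem_singleton] at hq
  subst hq
  exact ⟨hkol, le_trans (by omega) hidx, hF⟩

open Summit.BirchSwinnertonDyer.BirchSwinnertonDyer.Theses.ByReductionTypeAtTwo
  (GoodOrdinaryRankZeroAtTwo MultiplicativeRankZeroAtTwo SupersingularRankZeroAtTwo AdditiveRankZeroAtTwo) in
/-- **K₄⁻ AT AN OFF-CUT `𝒩`-FRAME ⟸ WALL row 1 + U₂ + Q2 + PRINT + N1 + N2 (sorry-free given the two stubs).**  `BSD₂(E)` (WALL rows) and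
`BSD₂(Wd)` (U₂) give `#Ш(E/K)[2^∞] = 4^(M₀)` (LEAD pair ledger), hence a sharp class in `Ш(E/ℚ)` and a sharp Selmer class (LEAD, no cut); N2 makes it
span-clean using `𝒩(Wd)`; §3 concludes.  Nothing is closed: WALL row 1, U₂, Q2 are OPEN route items. -/
theorem offCut_of_wall_U2_of_twinBit (hOrd : GoodOrdinaryRankZeroAtTwo) (hMult : MultiplicativeRankZeroAtTwo)
    (hSS : SupersingularRankZeroAtTwo) (hAdd : AdditiveRankZeroAtTwo) (hTw : MinimalTwinBSDTwo) (hQ2 : KolyvaginRelationAtTwo)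
    (hGZ : GrossZagierAllLevels) (hGZK : MultPublishedInputsAtTwo) (hL : EntireLFunctionRat) (hMi : MilneAnyModel)
    (W : WeierstrassCurve ℚ) [W.IsElliptic] [W.IsGloballyMinimal] [NeZero (W.conductorNorm ℤ)]
    (hcm : ¬ W.HasCM) (hr0 : W.analyticRank = 0) (hρ : ∀ n : ℕ, 0 < n → W.HasSurjectiveModNGaloisRep ((2 : ℤ) ^ n))
    (hT : Odd W.tamagawaProduct) (hneg : W.Δ < 0) (h4 : Nat.card (W.selmerGroup 2) = 4)
    (hoff : ¬ ∃ v : HeightOneSpectrum (𝓞 ℚ), ((2 : ℕ) : 𝓞 ℚ) ∉ v.asIdeal ∧ ((W.conductorNorm ℤ : ℕ) : 𝓞 ℚ) ∈ v.asIdeal ∧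
      W.HasMultiplicativeReductionAt v)
    (K : Type) [Field K] [NumberField K] (hIQ : IsImaginaryQuadratic K) (hodd : Odd (NumberField.discr K))
    (h3 : NumberField.discr K ≠ -3) (hHe : SatisfiesHeegnerHypothesis (W.conductorNorm ℤ) K)
    (hsq1 : ¬ IsSquare ((NumberField.discr K : ℚ) * -|W.Δ|)) (hsq2 : ¬ IsSquare ((NumberField.discr K : ℚ) * (-(2 * |W.Δ|))))
    (ℓ : ℕ) (hℓ : ℓ.Prime) (hdK : NumberField.discr K = -(ℓ : ℤ))
    (h2K : ((Ideal.span {(2 : ℤ)}).primesOver (𝓞 K)).ncard = 2)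
    (Dt : ModularParametrizationData W (W.conductorNorm ℤ))
    (hopt : ∀ z ∈ Dt.L.lattice, ∃ w ∈ periodLattice Dt.f, z = (Dt.c : ℂ) * w) (hc : Odd Dt.c)
    (β : ℤ) (ι : K →+* ℂ) (d₁ : KolyvaginHeegnerData Dt β ι 1) (hy : ¬ IsOfFinAddOrder d₁.derivedPoint)
    (M₀ : ℕ) (hdiv : ∃ Q : (W.baseChange (ringClassField K ι 1)).toAffine.Point, ((2 ^ M₀ : ℕ) : ℤ) • Q = d₁.derivedPoint)
    (hndiv : ¬ ∃ Q : (W.baseChange (ringClassField K ι 1)).toAffine.Point, ((2 ^ (M₀ + 1) : ℕ) : ℤ) • Q = d₁.derivedPoint)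
    (hM₀ : 1 ≤ M₀)
    (Wd : WeierstrassCurve ℚ) [Wd.IsElliptic] [Wd.IsGloballyMinimal]
    (hWd : ∃ C : VariableChange ℚ, C • W.quadraticTwist (NumberField.discr K : ℚ) = Wd)
    (hrd : Wd.analyticRank = 1) (hSel : Nat.card (Wd.selmerGroup 2) = 2) (hDEF : padicValNat 2 Wd.tamagawaProduct ≤ 1)
    (hN : TwinNonPhantomBit Wd) :
    ∃ (n : ℕ) (d : KolyvaginHeegnerData Dt β ι n), Squarefree n ∧
      (∀ ℓ ∈ n.primeFactors, Zhang2014.IsKolyvaginPrime (W.conductorNorm ℤ) W K 2 ℓ ∧ 2 ≤ Zhang2014.kolyvaginIndex W 2 ℓ ∧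
        FrobEqFrobInfty W K 2 ℓ) ∧
      ¬ ∃ Q : (W.baseChange (ringClassField K ι n)).toAffine.Point, (2 : ℤ) • Q = d.derivedPoint := by
  haveI : Fact (Nat.Prime 2) := ⟨Nat.prime_two⟩
  have hs2 : W.HasSurjectiveModNGaloisRep 2 := by simpa using hρ 1 one_pos
  have hw : W.rootNumber = 1 :=
    (Literature.Barriers.BirchSwinnertonDyer.even_analyticRank_iff_of_isNewformOf_conductorLevel Dt.isNewformOf).mp
      (by rw [hr0]; exact Even.zero)
  have hrk0 : W.mordellWeilRank = 0 := by rw [(hGZK W (by rw [hr0]; exact zero_le_one)).1, hr0]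
  have hBW : BSDp W 2 := bsdp_of_wallRows hOrd hMult hSS hAdd W hcm hr0
  have hBd : BSDp Wd 2 := hTw Wd (not_hasCM_twin W hcm K Wd hWd) hrd hSel
  have hpow :=
    Summit.BirchSwinnertonDyer.BirchSwinnertonDyer.Theorems.GenusSupplyNarrow.Lossless.natCard_primaryComponent_sha_baseChange_two_eq_pow_of_bsdp_pair
      hGZ hL hGZK hMi W hs2 hT hr0 K hIQ hodd h3 hHe Dt hc β ι d₁ M₀ hdiv hndiv Wd hWd hrd hBW hBd
  obtain ⟨k, a, ha, hka, hne⟩ :=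
    Summit.BirchSwinnertonDyer.BirchSwinnertonDyer.Theorems.GenusExact.PlusDescent.exists_mem_sha_two_pow_pred_smul_ne_zero_of_natCard_eq_pow
      W K hT hIQ hodd hHe hs2 Dt β ι d₁ hy M₀ hM₀ hndiv hw hrk0 Wd hWd hSel (Or.inl ⟨hneg, hDEF⟩) hpow
  rcases Nat.eq_zero_or_pos k with rfl | hkpos
  · rw [pow_zero, Nat.cast_one, one_zsmul] at hka
    exact (hne (by rw [hka, zsmul_zero])).elim
  · have hn : ((2 ^ k : ℕ) : ℤ) ≠ 0 := by positivity
    have hmem : a ∈ W.sha ⊓ AddSubgroup.torsionBy W.galH1 ((2 ^ k : ℕ) : ℤ) :=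
      AddSubgroup.mem_inf.mpr ⟨ha, by change ((2 ^ k : ℕ) : ℤ) • a = 0; exact hka⟩
    rw [← WeierstrassCurve.map_torsionH1ToH1_selmerGroup_holds W hn] at hmem
    obtain ⟨x, hx, rfl⟩ := AddSubgroup.mem_map.mp hmem
    have hne' : ((2 ^ (M₀ - 1) : ℕ) : ℤ) • x ≠ 0 := fun h ↦ hne (by rw [← map_zsmul, h, map_zero])
    obtain ⟨M, s₀, hM₀M, hs₀, hne₀, hSpan⟩ :=
      stub_spanCleanSharpClass W hcm hr0 hρ hT hneg h4 hoff K hIQ hodd h3 hHe hsq1 hsq2 ℓ hℓ hdK h2K Dt hopt hc β ι d₁ hy M₀ hdiv hndiv hM₀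
        Wd hWd hrd hSel hDEF hBW hBd hN ⟨k, x, hx, hne'⟩
    exact kFour_shape_of_spanLocal hQ2 W hcm hneg hT K hIQ hodd h3 hHe hsq1 hρ Dt β ι d₁ M₀ hndiv hw M hM₀M s₀ hs₀ hne₀ hSpan

/-! ## §4 COMPOSITION — `K4Neg` ⟸ WALL row 1 + U₂ + Q2 + PRINT + {N1, N2, P}; sorries ONLY inside the three stubs -/

open Summit.BirchSwinnertonDyer.BirchSwinnertonDyer.Theses.ByReductionTypeAtTwo
  (GoodOrdinaryRankZeroAtTwo MultiplicativeRankZeroAtTwo SupersingularRankZeroAtTwo AdditiveRankZeroAtTwo) in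
/-- **COMPOSITION (LINE 37) — `K4Neg` ⟸ WALL row 1 + U₂ + Q2 + PRINT + N1 + N2 + P.**  On the cut: §1 (`onCut_of_wall_U2`, no stub).  Off the cut and
multiplicative at `2`: `offCut_of_wall_U2_of_nonPhantom` fed by gk2-p5's Tate witness (no stub).  Off the cut, not multiplicative at `2`: split by the
twin's bit — `𝒩(Wd)`: `offCut_of_wall_U2_of_twinBit` (stubs N1, N2); `𝒫`: the residual P.  `K4Neg` is NOT proved (N1, N2, P open; WALL row 1, U₂, Q2 are
OPEN route items); BSD is not proved; no summit is proved by a line. -/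
theorem K4Neg_of_wall_U2_frobeniusSplit (hOrd : GoodOrdinaryRankZeroAtTwo) (hMult : MultiplicativeRankZeroAtTwo)
    (hSS : SupersingularRankZeroAtTwo) (hAdd : AdditiveRankZeroAtTwo) (hTw : MinimalTwinBSDTwo) (hQ2 : KolyvaginRelationAtTwo)
    (hGZ : GrossZagierAllLevels) (hGZK : MultPublishedInputsAtTwo) (hL : EntireLFunctionRat) (hMi : MilneAnyModel) :
    Summit.BirchSwinnertonDyer.BirchSwinnertonDyer.Theses.GenusKolyvaginAtTwo.K4Neg := by
  intro W _ _ _ hcm hr0 hρ hT hneg h4 K _ _ hIQ hodd h3 hHe hsq1 hsq2 ℓ₀ hℓ₀ hdK h2K Dt hopt hc β ι d₁ hy M₀ hdiv hndiv hM₀ Wd _ _ hWd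
    hrd hSel hDEF
  by_cases hcut : ∃ v : HeightOneSpectrum (𝓞 ℚ), ((2 : ℕ) : 𝓞 ℚ) ∉ v.asIdeal ∧ ((W.conductorNorm ℤ : ℕ) : 𝓞 ℚ) ∈ v.asIdeal ∧
      W.HasMultiplicativeReductionAt v
  · obtain ⟨v, h2v, hNv, hmult⟩ := hcut
    exact onCut_of_wall_U2 hOrd hMult hSS hAdd hTw hQ2 hGZ hGZK hL hMi W hcm hr0 hρ hT hneg h4 v h2v hNv hmult K hIQ hodd h3 hHe hsq1 hsq2 ℓ₀
      hℓ₀ hdK h2K Dt hopt hc β ι d₁ hy M₀ hdiv hndiv hM₀ Wd hWd hrd hSel hDEF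
  · by_cases hm2 : ∃ v₂ : HeightOneSpectrum (𝓞 ℚ), ((2 : ℕ) : 𝓞 ℚ) ∈ v₂.asIdeal ∧ W.HasMultiplicativeReductionAt v₂
    · obtain ⟨v₂, h2v, hmult⟩ := hm2
      exact offCut_of_wall_U2_of_nonPhantom hOrd hMult hSS hAdd hTw hQ2 hGZ hGZK hL hMi W hcm hr0 hρ hT hneg h4 hcut K hIQ hodd h3 hHe hsq1
        hsq2 ℓ₀ hℓ₀ hdK h2K Dt hopt hc β ι d₁ hy M₀ hdiv hndiv hM₀ Wd hWd hrd hSel hDEF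
        (fun L hL z hz hw ↦ Summit.BirchSwinnertonDyer.BirchSwinnertonDyer.Theorems.GenusExact.Lw2PhantomExclusion.k4Neg_offCutNonPhantomAtTwo_of_hasMultiplicativeReductionAt_two
          W hcm hr0 hρ hT hneg h4 hcut K hIQ hodd h3 hHe hsq1 hsq2 h2K h2v hmult L hL z hz (fun w _ ↦ hw w))
    · by_cases hN : TwinNonPhantomBit Wd
      · exact offCut_of_wall_U2_of_twinBit hOrd hMult hSS hAdd hTw hQ2 hGZ hGZK hL hMi W hcm hr0 hρ hT hneg h4 hcut K hIQ hodd h3 hHe hsq1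
          hsq2 ℓ₀ hℓ₀ hdK h2K Dt hopt hc β ι d₁ hy M₀ hdiv hndiv hM₀ Wd hWd hrd hSel hDEF hN
      · exact stub_offCut_notMultAtTwo_phantomTwin W hcm hr0 hρ hT hneg h4 hcut hm2 K hIQ hodd h3 hHe hsq1 hsq2 ℓ₀ hℓ₀ hdK h2K Dt hopt hc
          β ι d₁ hy M₀ hdiv hndiv hM₀ Wd hWd hrd hSel hDEF hN

/-! ## §5 TYPED PROPOSALS (not stubs of the composition; refutable by the instrument) -/

/-- **T_𝒫 (typed, instrument-backed conjecture): THE PHANTOM TWIN IS READ OFF `Frob_(ℓ₀)`.**  For a K₄⁻ frame off the cut (curve and twin binders as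
in the cell, prime frame `disc K = −ℓ₀`), the twin bit fails iff the Lawson–Wuthrich class of `E` is locally trivial at `ℓ₀`:
`¬𝒩(Wd) ⟺ loc_(ℓ₀) ξ = 0`, PROVIDED `ξ ∈ Sel₂(E)` (true on the not-2-multiplicative off-cut habitat: LW2 32/32, T_C; FALSE on the 2-multiplicative
slice by gk2-p5, where `𝒩` then holds outright).  (Mazur–Rubin, Lemma 2.11 «transversality of local conditions after twist»: at the ramified good odd
prime `H¹_f(E) ∩ H¹_f(E^d) = 0`; Lemma 2.10 (i),(iv),(v): equal local conditions at the split places `2`, `p ∣ N`, at `∞` (`Δ < 0`) and at good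
unramified places; hence `Sel₂(E) ∩ Sel₂(E^d) = Sel₂(E)[loc_(ℓ₀) = 0]` and `π_d = ξ ⟺ ξ ∈ Sel₂(E^d)`.) [cite: MazurRubin2010Invent, Lemma 2.10–2.11]
Consequence: `c_(ℓ₀)(Wd) = 1 ⟹ 𝒫`; `c_(ℓ₀)(Wd) = 2 ⟹` each of `𝒫`, `𝒩` on a Čebotarev set of density `1/2` among such `ℓ₀`.  Falsifier: one frame of kit
j341556 with `𝒫 ≠ LOCXI0`. [cite: Kramer1981, Prop. 4.2–4.3, Thm. 1] [cite: LawsonWuthrich2016, §7.1] -/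
def PhantomTwinIffLocTrivial_T : Prop :=
  ∀ (W : WeierstrassCurve ℚ) [W.IsElliptic] [W.IsGloballyMinimal] [NeZero (W.conductorNorm ℤ)],
    ¬ W.HasCM → W.Δ < 0 → Odd W.tamagawaProduct →
    (¬ ∃ v : HeightOneSpectrum (𝓞 ℚ), ((2 : ℕ) : 𝓞 ℚ) ∉ v.asIdeal ∧ ((W.conductorNorm ℤ : ℕ) : 𝓞 ℚ) ∈ v.asIdeal ∧
      W.HasMultiplicativeReductionAt v) →
    (∀ n : ℕ, 0 < n → W.HasSurjectiveModNGaloisRep ((2 : ℤ) ^ n)) →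
    ∀ (K : Type) [Field K] [NumberField K], IsImaginaryQuadratic K → SatisfiesHeegnerHypothesis (W.conductorNorm ℤ) K →
    ∀ (ℓ₀ : ℕ), ℓ₀.Prime → NumberField.discr K = -(ℓ₀ : ℤ) → ((Ideal.span {(2 : ℤ)}).primesOver (𝓞 K)).ncard = 2 →
    ∀ (Wd : WeierstrassCurve ℚ) [Wd.IsElliptic] [Wd.IsGloballyMinimal],
    (∃ C : VariableChange ℚ, C • W.quadraticTwist (NumberField.discr K : ℚ) = Wd) → 0 < Wd.mordellWeilRank →
    Nat.card (Wd.selmerGroup 2) = 2 →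
    ∀ x : galH1Torsion W ((2 : ℕ) : ℤ), x ≠ 0 → x ∈ selmerGroup W ((2 : ℕ) : ℤ) →
    (∀ h ∈ torsionFixing W ((4 : ℕ) : ℤ), h1Eval W ((2 : ℕ) : ℤ) x h = 0) →
    (¬ TwinNonPhantomBit Wd ↔
      ∀ v : HeightOneSpectrum (𝓞 ℚ), (ℓ₀ : 𝓞 ℚ) ∈ v.asIdeal → x ∈ W.torsionLocalKer (v.adicCompletion ℚ) ((2 : ℕ) : ℤ))

end Summit.BirchSwinnertonDyer.BirchSwinnertonDyer.Cruxes.K4Neg.FrobeniusSplit
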